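import Summits.Ventures.PercRepro.ProfilePointedCircuitClassesPairFive

/-!
# PercRepro — THE PER-PAIR IN–OUT INEQUALITY AT THE BOTTOM OF NULLITY 5: THE COLOOP REDUCTION (p5, gen 42;
`proofs/P5-GM1.md` §63(b))

The pair analogue of `inOutBottomFive_of_coloopFree_twinFree`: for a pair `S` on `#E = ρ(E) + 5`, `ρ(E) ≥ 7`, a
coloop inside `S` kills `thru_5(S)`, a coloop `x ∉ S` is deleted (`thru_5^N(S) ≤ thru_5^{N∖x}(S)`, the bottom-level
demands avoid every coloop; `thru_{n−7}^{N∖x}(S) ≤ thru_{n−6}^N(S)`, `X ↦ X + x`), down to the rank-6 row where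
`thru_5(S) = thru_{n−6}(S)` is an identity (`n − 6 = 5`).  With the dependent and twin cases of `PairFive`:
**`InOutPairBottomFive` holds as soon as it holds on coloop-free matroids for independent pairs both of whose points
are twin-free** (`inOutPairBottomFive_of_coloopFree_twinFree`).
-/

open scoped Matroid

namespace PercRepro.Cogirth

open Finset ThmH Skew Shadow Profile

variable {α : Type} [DecidableEq α] {N : Matroid α} [N.Finite]

section PairFiveReduce

/-- A coloop lies in no bottom-level bi-independent set: `thru_ν(S) = 0` when `S` contains a coloop. -/
theorem thruCount_bottom_eq_zero_of_coloop_mem {S : Finset α} {s : α} (hs : s ∈ S)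
    (hco : rk N ((gr N).erase s) < rk N (gr N)) : thruCount N ((gr N).card - rk N (gr N)) S = 0 := by
  unfold thruCount
  rw [card_eq_zero, filter_eq_empty_iff]
  intro W hW hSW
  rw [mem_biIndepSets] at hW
  obtain ⟨hWg, hWcard, _, hWcompl⟩ := hW
  have hsW : s ∈ W := hSW hs
  have hsub : gr N \ W ⊆ (gr N).erase s := by
    intro a ha
    rw [mem_sdiff] at ha
    rw [mem_erase]
    exact ⟨fun h => ha.2 (h ▸ hsW), ha.1⟩
  have h1 : rk N (gr N \ W) ≤ rk N ((gr N).erase s) := rk_le_rk_of_subset_finset hsub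
  have h2 : (gr N \ W).card = rk N (gr N) := by
    rw [card_sdiff_of_subset hWg, hWcard]
    have := card_le_card hWg
    have := rk_le_card (M := N) (gr N)
    omega
  rw [hWcompl, h2] at h1
  omega

/-- **The bottom-level sets through `S` survive the deletion of a coloop `x ∉ S`**, at every nullity `ν = #E − ρ(E)`:
a bi-independent `ν`-set `W ⊇ S` avoids `x` (the basis `E ∖ W` contains every coloop) and stays bi-independent in
`N ∖ x`. -/
theorem thruCount_bottom_le_thruCount_delete_of_coloop {ν : ℕ} {x : α} (hn : (gr N).card = rk N (gr N) + ν)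
    (hco : rk N ((gr N).erase x) < rk N (gr N)) (S : Finset α) :
    thruCount N ν S ≤ thruCount (N ＼ ({x} : Set α)) ν S := by
  unfold thruCount
  apply card_le_card
  intro W hW
  rw [mem_filter, mem_biIndepSets] at hW
  obtain ⟨⟨hWg, hWν, hWr, hWc⟩, hSW⟩ := hW
  have hBcard : (gr N \ W).card = rk N (gr N) := by rw [card_sdiff_of_subset hWg, hn, hWν]; omega
  have hxW : x ∉ W := by
    intro hxW
    have hsub : gr N \ W ⊆ (gr N).erase x := by
      intro g hg
      rw [mem_sdiff] at hg
      exact mem_erase.2 ⟨fun h => hg.2 (h ▸ hxW), hg.1⟩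
    have h1 := rk_mono' (M := N) hsub
    omega
  have hWx : W ⊆ (gr N).erase x := fun g hg => mem_erase.2 ⟨fun h => hxW (h ▸ hg), hWg hg⟩
  rw [mem_filter, mem_biIndepSets, gr_delete']
  refine ⟨⟨hWx, hWν, ?_, ?_⟩, hSW⟩
  · rw [rk_delete hWx]; exact hWr
  · have e1 : (gr N).erase x \ W = (gr N \ W).erase x := by
      ext g
      rw [mem_sdiff, mem_erase, mem_erase, mem_sdiff]
      tauto
    rw [e1, rk_delete (erase_subset_erase x sdiff_subset)]
    exact rk_eq_card_of_subset_of_rk_eq_card (erase_subset x (gr N \ W)) hWc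

/-- **The sets through `S` of `N ∖ x` lift to `N`** for a coloop `x ∉ S`: a bi-independent `k`-set `X ⊇ S` of `N ∖ x`
gives the bi-independent `(k + 1)`-set `X + x ⊇ S` of `N` (`x` lies outside the closure of every subset of
`E − x`; the complement `(E − x) ∖ X` is unchanged), injectively; `x ∉ S` is automatic. -/
theorem thruCount_delete_le_thruCount_succ_of_coloop (k : ℕ) {x : α} (hx : x ∈ gr N)
    (hco : rk N ((gr N).erase x) < rk N (gr N)) (S : Finset α) :
    thruCount (N ＼ ({x} : Set α)) k S ≤ thruCount N (k + 1) S := by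
  unfold thruCount
  apply card_le_card_of_injOn (fun X => insert x X)
  · intro X hX
    rw [mem_coe, mem_filter, mem_biIndepSets, gr_delete'] at hX
    obtain ⟨⟨hXg, hXk, hXr, hXc⟩, hSX⟩ := hX
    rw [rk_delete hXg] at hXr
    rw [rk_delete (sdiff_subset (s := (gr N).erase x) (t := X))] at hXc
    have hxX : x ∉ X := fun h => (mem_erase.1 (hXg h)).1 rfl
    have hXg' : X ⊆ gr N := hXg.trans (erase_subset x (gr N))
    rw [mem_coe, mem_filter, mem_biIndepSets]
    refine ⟨⟨insert_subset hx hXg', ?_, ?_, ?_⟩, hSX.trans (subset_insert x X)⟩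
    · rw [card_insert_of_notMem hxX, hXk]
    · rw [rk_insert_eq hx hXg', if_neg (notMem_clF_of_rk_erase_lt hx hco hXg), hXr,
        card_insert_of_notMem hxX]
    · have e1 : gr N \ insert x X = (gr N).erase x \ X := by
        ext g
        rw [mem_sdiff, mem_insert, mem_sdiff, mem_erase]
        tauto
      rw [e1]
      exact hXc
  · intro X₁ hX₁ X₂ hX₂ h
    rw [mem_coe, mem_filter, mem_biIndepSets, gr_delete'] at hX₁ hX₂
    have h₁ : x ∉ X₁ := fun h' => (mem_erase.1 (hX₁.1.1 h')).1 rfl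
    have h₂ : x ∉ X₂ := fun h' => (mem_erase.1 (hX₂.1.1 h')).1 rfl
    simp only at h
    rw [← erase_insert h₁, ← erase_insert h₂, h]

/-- **THE REDUCTION OF `InOutPairBottomFive` TO COLOOP-FREE MATROIDS AND TWIN-FREE INDEPENDENT PAIRS**: by strong
induction on `#E` — a coloop inside `S` (`thru_5 = 0`), a coloop `x ∉ S` (rank `7`: delete `x` to the rank-6 row,
where `thru_5(S) = thru_{n−6}(S)` is an identity; rank `≥ 8`: delete `x` and induct), then the dependent and twin
cases (`PairFive`), else the hypothesis. -/
theorem thruCount_five_le_of_seven_le_of_cf_tf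
    (h : ∀ (N : Matroid α) [N.Finite] (S : Finset α), S ⊆ gr N → S.card = 2 → rk N S = 2 →
      (gr N).card = rk N (gr N) + 5 → 7 ≤ rk N (gr N) →
      (∀ x ∈ gr N, rk N ((gr N).erase x) = rk N (gr N)) →
      (∀ s ∈ S, ∀ f ∈ gr N, f ≠ s → rk N {f} = 1 → f ∉ clF N {s}) →
      thruCount N 5 S ≤ thruCount N ((gr N).card - 6) S)
    (n : ℕ) :
    ∀ (N : Matroid α) [N.Finite] (S : Finset α), (gr N).card = n → S ⊆ gr N → S.card = 2 →
      (gr N).card = rk N (gr N) + 5 → 7 ≤ rk N (gr N) → thruCount N 5 S ≤ thruCount N ((gr N).card - 6) S := by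
  induction n using Nat.strong_induction_on with
  | _ n ih =>
    intro N _ S hcard hSg hS2 hn hR
    -- a coloop inside `S`
    by_cases hcs : ∃ s ∈ S, rk N ((gr N).erase s) < rk N (gr N)
    · obtain ⟨s, hs, hco⟩ := hcs
      have h0 := thruCount_bottom_eq_zero_of_coloop_mem hs hco
      have e5 : (gr N).card - rk N (gr N) = 5 := by omega
      rw [e5] at h0
      rw [h0]
      exact Nat.zero_le _
    -- a coloop `x ∉ S`
    by_cases hx : ∃ x ∈ gr N, x ∉ S ∧ rk N ((gr N).erase x) < rk N (gr N)
    · obtain ⟨x, hxg, hxS, hco⟩ := hx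
      have hrk : rk N ((gr N).erase x) + 1 = rk N (gr N) := by
        have := rk_le_rk_erase_add_one (M := N) (Subset.refl (gr N)) hxg
        omega
      have h1 := thruCount_bottom_le_thruCount_delete_of_coloop (ν := 5) hn hco S
      have h2 := thruCount_delete_le_thruCount_succ_of_coloop ((gr N).card - 7) hxg hco S
      have e2 : (gr N).card - 7 + 1 = (gr N).card - 6 := by omega
      rw [e2] at h2
      have hn' : (gr (N ＼ ({x} : Set α))).card =
          rk (N ＼ ({x} : Set α)) (gr (N ＼ ({x} : Set α))) + 5 := by
        rw [gr_delete', card_erase_of_mem hxg, rk_delete (Subset.refl _)]; omega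
      have hSg' : S ⊆ gr (N ＼ ({x} : Set α)) := by
        rw [gr_delete']
        intro a ha
        exact mem_erase.2 ⟨fun h' => hxS (h' ▸ ha), hSg ha⟩
      have hcard' : (gr (N ＼ ({x} : Set α))).card = (gr N).card - 1 := by
        rw [gr_delete', card_erase_of_mem hxg]
      rcases Nat.lt_or_ge (rk N (gr N)) 8 with h7 | h8
      · -- rank `7`: the minor has `11` points and rank `6`, where `n° − 6 = 5` and the two sides coincide
        have e3 : (gr (N ＼ ({x} : Set α))).card - 6 = 5 := by rw [hcard']; omega
        have e4 : (gr N).card - 7 = 5 := by omega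
        rw [e4] at h2
        omega
      · have h3 := ih ((gr N).card - 1) (by omega) (N ＼ ({x} : Set α)) S hcard' hSg' hS2 hn'
          (by rw [gr_delete', rk_delete (Subset.refl _)]; omega)
        rw [hcard'] at h3
        have e3 : (gr N).card - 1 - 6 = (gr N).card - 7 := by omega
        rw [e3] at h3
        omega
    -- no coloop at all
    · have hcf : ∀ x ∈ gr N, rk N ((gr N).erase x) = rk N (gr N) := by
        intro x hxg
        have hle := rk_mono' (M := N) (erase_subset x (gr N))
        by_cases hxS : x ∈ S
        · have : ¬ rk N ((gr N).erase x) < rk N (gr N) := fun h' => hcs ⟨x, hxS, h'⟩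
          omega
        · have : ¬ rk N ((gr N).erase x) < rk N (gr N) := fun h' => hx ⟨x, hxg, hxS, h'⟩
          omega
      -- dependent pair?
      by_cases hdep : rk N S < S.card
      · rw [thruCount_eq_zero_of_rk_lt hdep]
        exact Nat.zero_le _
      have hrkS : rk N S = 2 := by
        have := rk_le_card (M := N) S
        omega
      -- a twin of a point of `S`?
      by_cases htw : ∃ s ∈ S, ∃ f ∈ gr N, f ≠ s ∧ rk N {f} = 1 ∧ f ∈ clF N {s}
      · obtain ⟨s, hs, f, hf, hfs, hrf, hfcl⟩ := htw
        obtain ⟨s₁, s₂, hs12, rfl⟩ := card_eq_two.1 hS2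
        have hs₁g : s₁ ∈ gr N := hSg (mem_insert_self _ _)
        have hs₂g : s₂ ∈ gr N := hSg (mem_insert_of_mem (mem_singleton_self _))
        have hr1 : rk N {s₁} = 1 := by
          have h1 := rk_eq_card_of_subset_of_rk_eq_card (singleton_subset_iff.2 (mem_insert_self s₁ {s₂}))
            (by rw [hrkS, card_pair hs12])
          rwa [card_singleton] at h1
        have hr2 : rk N {s₂} = 1 := by
          have h1 := rk_eq_card_of_subset_of_rk_eq_card
            (singleton_subset_iff.2 (mem_insert_of_mem (mem_singleton_self s₂) : s₂ ∈ ({s₁, s₂} : Finset α)))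
            (by rw [hrkS, card_pair hs12])
          rwa [card_singleton] at h1
        have hfS : f ∉ ({s₁, s₂} : Finset α) := by
          intro hfS
          have hsub : ({s, f} : Finset α) ⊆ {s₁, s₂} := insert_subset hs (singleton_subset_iff.2 hfS)
          have h1 : rk N {s, f} ≤ rk N {s} := by
            have e1 : ({s, f} : Finset α) = insert f {s} := pair_comm s f
            rw [e1, rk_insert_eq hf (singleton_subset_iff.2 (hSg hs)), if_pos hfcl]
          have h2 : rk N {s, f} = 2 := by
            have := rk_eq_card_of_subset_of_rk_eq_card hsub (by rw [hrkS, card_pair hs12])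
            rwa [card_pair (fun h' => hfs h'.symm)] at this
          have h3 : rk N {s} ≤ 1 := by
            have := rk_le_card (M := N) {s}
            rwa [card_singleton] at this
          omega
        have hfs₁ : s₁ ≠ f := fun h' => hfS (h' ▸ mem_insert_self _ _)
        have hfs₂ : s₂ ≠ f := fun h' => hfS (h' ▸ mem_insert_of_mem (mem_singleton_self _))
        rw [mem_insert, mem_singleton] at hs
        rcases hs with rfl | rfl
        · exact thruCount_five_le_of_parallel hn hR hs12 hfs₁ hfs₂ hs₁g hs₂g hf hr1 hrf hfcl
        · have e : ({s₁, s} : Finset α) = {s, s₁} := pair_comm s₁ s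
          rw [e]
          exact thruCount_five_le_of_parallel hn hR hs12.symm hfs₂ hfs₁ hs₂g hs₁g hf hr2 hrf hfcl
      · exact h N S hSg hS2 hrkS hn hR hcf (fun s hs f hf hfs hrf hfcl => htw ⟨s, hs, f, hf, hfs, hrf, hfcl⟩)

/-- **`InOutPairBottomFive` HOLDS AS SOON AS IT HOLDS ON COLOOP-FREE MATROIDS FOR TWIN-FREE INDEPENDENT PAIRS** (§63(b)):
the coloop, dependent and twin cases are theorems. -/
theorem inOutPairBottomFive_of_coloopFree_twinFree
    (h : ∀ (N : Matroid α) [N.Finite] (S : Finset α), S ⊆ gr N → S.card = 2 → rk N S = 2 →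
      (gr N).card = rk N (gr N) + 5 → 7 ≤ rk N (gr N) →
      (∀ x ∈ gr N, rk N ((gr N).erase x) = rk N (gr N)) →
      (∀ s ∈ S, ∀ f ∈ gr N, f ≠ s → rk N {f} = 1 → f ∉ clF N {s}) →
      thruCount N 5 S ≤ thruCount N ((gr N).card - 6) S) :
    InOutPairBottomFive α := by
  intro N _ S hSg hS2 hn hR
  exact thruCount_five_le_of_seven_le_of_cf_tf h (gr N).card N S rfl hSg hS2 hn hR

end PairFiveReduce

end PercRepro.Cogirth
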